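/-
Copyright: the b2b-balaban T⁴-continuum CRUX team, row NE7b leaf lineage `t4-ne7b-formalise-leaf-06` (gen 159). Project licence.
-/
import Summits.QuantumFields.BalabanUV.T4Continuum.Spine.NE7b.OneShotChartMixedNorm

/-!
# THE ONE-SHOT SECTION IN THE MIXED CURRENCY — «WINDOW + TAIL»: the Minkowski glue next to `OneShotChartMixedNorm.blockRMS_HB_le_of_certificate`,
# so that a dual certificate `(w, λ)` on a finite window `T` and ONE tail number `τ` substitute in one line:
# `RMS_{B(y″)}(H_{T′}B) ≤ (√(λ(Σ_{y∈T}w_y)∕(n+1)^d) + τ)·‖B‖_{ℓ^∞(T′)}` for every finite `T′ ⊇ T`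
# (row NE7b, node U5c; PRICING-NE7b v123 F733 (d) ∕ F738 (c) — the desk's located ask on OSCMN; [folklore] over `B5Hk103ScalarZd` + OSCMN BY NAME)

Cell `pub-balaban`, sub-cell `t4`, spine estimate NE7b (`T4WeightBudget.RelWeightBound`; the cell's OWN estimate — NOT PRINTED in
[Bałaban 1983–89], NOT PROVED).  Crux-route work under `Spine/NE7b/` by leaf-06 (CRUX team (2), FREEZE (0) crux-prover clause).
NOTHING of Bałaban's is named as a Lean object, valued or asserted; no `T4Continuum/Support` leaf typed; no `def`; zero `sorry`.
Import: `…Spine.NE7b.OneShotChartMixedNorm` ONLY (OSCMN: the mixed letter §2–§3 and the SDP-dual certificate socket §5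
`blockRMS_HB_le_of_certificate`; through it `Literature.….B5Hk103ScalarZd` — the kernel `kerH`, `cH`, `deltaH`, `kerH_blockRMS_le` — and
`B6QGQDecay237.card_B`).  A SIBLING file rather than an OSCMN §6 append: OSCMN stays byte-identical (its importers `FibreInverseMixedNorm` ∕
`BlockPropagatorMixedNorm` keep their oleans) and both files stay under the 400-line cap.

WHY.  PRICING-NE7b v123 F733 (d) (refuter g102, on OSCMN v1.1 p388337 ✓): «the socket is on a FINITE window `T`; the `ℤ^d` operator needs
«window + tail» glued by Minkowski in block-`ℓ²` (`RMS(H B) ≤ RMS(H B|_T) + R·Σ_{y∉T}RMS_{B(y″)}H(·,y)`) — one more [folklore] line, not in the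
file»; F738 (c): «the «window + tail» Minkowski glue in block-`ℓ²` as a lemma next to `blockRMS_HB_le_of_certificate`, so a certificate on `T_r`
and a tail number substitute in one line».  The desk's booked balaban-calc request NC-NE7b-GAMMA-1 (`requests.jsonl` l.4177) asks exactly for a
certificate `(w, λ)` on the window `T_r = {|y|_∞ ≤ r}` and a certified tail `τ_r(M) ≥ Σ_{y∉T_r}max_{p∈B(0)}|H(p,y)|`; THIS FILE is the kernel
receptacle for BOTH numbers on any finite outer window `T′ ⊇ T_r` (the `T′ → ℤ^d` limit lives in the `tsum` currency of `B5HkUniformL2Zd` ∕ the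
OWNER's (46) `OneShotChartSupNorm`, not here).  The column-sup form of the desk's tail dominates the column-RMS form used here
(`blockRMS_col_le_of_abs_le`: `RMS_{B(y″)}(H(·,y)) ≤ max_{p∈B(y″)}|H(p,y)|`), so their `τ_r` is admissible as `τ`.

WHAT IS PROVED (`kerH n a p y` the section's kernel, `B n y″` the block of side `n+1` at `y″`, finite coarse windows; all [folklore]):
* §1 `sqrt_sum_sq_HB_le_sum` ∕ **`blockRMS_HB_le_sum_blockRMS`** — COLUMN-WISE MINKOWSKI, no constant:
  `RMS_{B(y″)}(H_S B) ≤ Σ_{y∈S}|B(y)|·RMS_{B(y″)}(H(·,y))` (duality form of the triangle inequality in `ℓ²(B(y″))`, the self-duality trick inlined).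
* §2 the TAIL for `|B| ≤ R` on `S`: **`blockRMS_HB_le_mul_sum_blockRMS`** (`≤ R·Σ_{y∈S}RMS_{B(y″)}(H(·,y))` — the socket for one tail number),
  `blockRMS_HB_tail_le` (`≤ c_H·R·Σ_{y∈S}e^{−δ_H dist(y″,y)}` by the tree's `kerH_blockRMS_le`; by value the `10^{366}` family — SHAPE only),
  `blockRMS_col_le_of_abs_le` (`|H(p,y)| ≤ m` on the block ⇒ `RMS_{B(y″)}(H(·,y)) ≤ m`).
* §3 **`blockRMS_HB_split`** — Minkowski on the block for `T ⊆ T′`: `RMS_{B(y″)}(H_{T′}B) ≤ RMS_{B(y″)}(H_TB) + RMS_{B(y″)}(H_{T′∖T}B)`.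
* §4 the GLUED letters: **`blockRMS_HB_le_of_certificate_window`** (`≤ √(λ(Σ_{y∈T}w_y)∕(n+1)^d)·R + R·Σ_{y∈T′∖T}RMS_{B(y″)}(H(·,y))`),
  **`blockRMS_HB_le_of_certificate_add_tail`** (`≤ (√(λ(Σ_Tw)∕(n+1)^d) + τ)·R` — ONE-LINE SUBSTITUTION of `(w, λ)` and `τ`),
  `blockRMS_HB_le_of_certificate_window_byName` (the tail by `kerH_blockRMS_le`).

HONEST: [folklore] bookkeeping; no number enters (certificate and tail are DISPLAYED hypotheses — a balaban-calc certificate read here has ZERO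
kernel weight on Bałaban's estimate, F733 (e)); `ℤ^d`, finite windows, no torus; nothing of (A3) ∕ NC-NE7b-α.  BY-NAME EFFECT ON THE WALL: NONE.
NE7b NOT PRINTED ∕ NOT PROVED; spine PROVED 0∕9; rung (B)+1 on a FINITE torus — NOT infinite volume, NOT the mass gap, NOT Clay.
HONEST DEPENDENCY: continuum YM on T⁴ ⇐ BetaPertH ∧ nine spine estimates (0∕9 proved); BetaPertH ⇐ (D1) ∧ (D4) ∧ CAP+tail; G-an2-4 gates
asym, D1 and NE2∕3∕4.
-/

set_option autoImplicit false

namespace Summit.QuantumFields.BalabanUV.T4Continuum.NE7b.OneShotChartMixedNormTail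

open Finset
open Literature.MathematicalPhysics.QuantumFieldTheory.Balaban1983to89
open B6QGQLower276 (X B)
open B5Hk103ScalarZd (kerH cH deltaH cH_pos deltaH_pos kerH_blockRMS_le)
open OneShotChartMixedNorm (blockRMS_HB_le_of_certificate)

variable {d : ℕ}

/-! ## §1. Column-wise Minkowski on a block (the plan: split `H_{T′}B` by Minkowski into the window part, read by OSCMN §5's
certificate, and the tail, bounded column by column with no constant — §2–§4) -/

/-- **COLUMN-WISE MINKOWSKI ON A BLOCK, unnormalised** (duality form of the triangle inequality in `ℓ²(B(y″))`; no constant):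
`√(Σ_{p∈B(y″)}(Σ_{y∈S}H(p,y)B(y))²) ≤ Σ_{y∈S}|B(y)|·√(Σ_{p∈B(y″)}H(p,y)²)` for every finite coarse set `S`. [folklore] -/
theorem sqrt_sum_sq_HB_le_sum (n : ℕ) (a : ℝ) (y'' : X d) (S : Finset (X d)) (Bf : X d → ℝ) :
    Real.sqrt (∑ p ∈ B n y'', (∑ y ∈ S, kerH n a p y * Bf y) ^ 2)
      ≤ ∑ y ∈ S, |Bf y| * Real.sqrt (∑ p ∈ B n y'', kerH n a p y ^ 2) := by
  obtain ⟨F, hF⟩ : ∃ F : X d → ℝ, F = fun p => ∑ y ∈ S, kerH n a p y * Bf y := ⟨_, rfl⟩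
  obtain ⟨A, hA⟩ : ∃ A : ℝ, A = ∑ y ∈ S, |Bf y| * Real.sqrt (∑ p ∈ B n y'', kerH n a p y ^ 2) := ⟨_, rfl⟩
  have eF : ∀ p, ∑ y ∈ S, kerH n a p y * Bf y = F p := fun p => by rw [hF]
  simp_rw [eF]
  rw [← hA]
  have hA0 : 0 ≤ A := by rw [hA]; exact Finset.sum_nonneg fun y _ => by positivity
  have hS0 : 0 ≤ ∑ p ∈ B n y'', F p ^ 2 := Finset.sum_nonneg fun p _ => sq_nonneg _
  -- `Σ_p F² = Σ_y B(y)·⟨F, H(·,y)⟩_{B(y″)}`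
  have hswap : ∑ p ∈ B n y'', F p ^ 2 = ∑ y ∈ S, Bf y * ∑ p ∈ B n y'', F p * kerH n a p y := by
    calc ∑ p ∈ B n y'', F p ^ 2 = ∑ p ∈ B n y'', ∑ y ∈ S, F p * (kerH n a p y * Bf y) := by
          refine Finset.sum_congr rfl fun p _ => ?_
          rw [sq, ← Finset.mul_sum, eF]
      _ = ∑ y ∈ S, ∑ p ∈ B n y'', F p * (kerH n a p y * Bf y) := Finset.sum_comm
      _ = ∑ y ∈ S, Bf y * ∑ p ∈ B n y'', F p * kerH n a p y := by
          refine Finset.sum_congr rfl fun y _ => ?_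
          rw [Finset.mul_sum]
          exact Finset.sum_congr rfl fun p _ => by ring
  -- each column by Cauchy–Schwarz: `B(y)⟨F, H(·,y)⟩ ≤ ‖F‖·|B(y)|·‖H(·,y)‖`
  have hcol : ∀ y ∈ S, Bf y * ∑ p ∈ B n y'', F p * kerH n a p y
      ≤ Real.sqrt (∑ p ∈ B n y'', F p ^ 2) * (|Bf y| * Real.sqrt (∑ p ∈ B n y'', kerH n a p y ^ 2)) := by
    intro y _
    have hcs : |∑ p ∈ B n y'', F p * kerH n a p y|
        ≤ Real.sqrt (∑ p ∈ B n y'', F p ^ 2) * Real.sqrt (∑ p ∈ B n y'', kerH n a p y ^ 2) := by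
      rw [← Real.sqrt_mul hS0]
      exact Real.abs_le_sqrt (Finset.sum_mul_sq_le_sq_mul_sq (B n y'') F fun p => kerH n a p y)
    calc Bf y * ∑ p ∈ B n y'', F p * kerH n a p y ≤ |Bf y * ∑ p ∈ B n y'', F p * kerH n a p y| := le_abs_self _
      _ = |Bf y| * |∑ p ∈ B n y'', F p * kerH n a p y| := abs_mul _ _
      _ ≤ |Bf y| * (Real.sqrt (∑ p ∈ B n y'', F p ^ 2) * Real.sqrt (∑ p ∈ B n y'', kerH n a p y ^ 2)) :=
          mul_le_mul_of_nonneg_left hcs (abs_nonneg _)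
      _ = Real.sqrt (∑ p ∈ B n y'', F p ^ 2) * (|Bf y| * Real.sqrt (∑ p ∈ B n y'', kerH n a p y ^ 2)) := by ring
  have h0 : ∑ p ∈ B n y'', F p ^ 2 ≤ Real.sqrt (∑ p ∈ B n y'', F p ^ 2) * A := by
    calc ∑ p ∈ B n y'', F p ^ 2 = ∑ y ∈ S, Bf y * ∑ p ∈ B n y'', F p * kerH n a p y := hswap
      _ ≤ ∑ y ∈ S, Real.sqrt (∑ p ∈ B n y'', F p ^ 2) * (|Bf y| * Real.sqrt (∑ p ∈ B n y'', kerH n a p y ^ 2)) :=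
          Finset.sum_le_sum hcol
      _ = Real.sqrt (∑ p ∈ B n y'', F p ^ 2) * A := by rw [hA, Finset.mul_sum]
  -- the self-duality trick `‖F‖² ≤ ‖F‖·A ⇒ ‖F‖ ≤ A`
  by_cases hz : Real.sqrt (∑ p ∈ B n y'', F p ^ 2) = 0
  · rw [hz]; exact hA0
  · have hpos : 0 < Real.sqrt (∑ p ∈ B n y'', F p ^ 2) := lt_of_le_of_ne (Real.sqrt_nonneg _) (Ne.symm hz)
    have h2 : Real.sqrt (∑ p ∈ B n y'', F p ^ 2) * Real.sqrt (∑ p ∈ B n y'', F p ^ 2)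
        ≤ Real.sqrt (∑ p ∈ B n y'', F p ^ 2) * A := by
      rw [Real.mul_self_sqrt hS0]; exact h0
    exact le_of_mul_le_mul_left h2 hpos

/-- **COLUMN-WISE MINKOWSKI IN THE MIXED CURRENCY**: for every finite coarse set `S`, every block `y″`, every `d` and mesh,
`RMS_{B(y″)}(H_S B) ≤ Σ_{y∈S}|B(y)|·RMS_{B(y″)}(H(·,y))`, i.e.
`√((n+1)^{−d}Σ_{p∈B(y″)}(Σ_{y∈S}H(p,y)B(y))²) ≤ Σ_{y∈S}|B(y)|·√((n+1)^{−d}Σ_{p∈B(y″)}H(p,y)²)`. [folklore] -/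
theorem blockRMS_HB_le_sum_blockRMS (n : ℕ) (a : ℝ) (y'' : X d) (S : Finset (X d)) (Bf : X d → ℝ) :
    Real.sqrt ((((n : ℝ) + 1) ^ d)⁻¹ * ∑ p ∈ B n y'', (∑ y ∈ S, kerH n a p y * Bf y) ^ 2)
      ≤ ∑ y ∈ S, |Bf y| * Real.sqrt ((((n : ℝ) + 1) ^ d)⁻¹ * ∑ p ∈ B n y'', kerH n a p y ^ 2) := by
  have hN : (0 : ℝ) < ((n : ℝ) + 1) ^ d := by positivity
  have hNi : 0 ≤ (((n : ℝ) + 1) ^ d)⁻¹ := inv_nonneg.mpr hN.le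
  have e : ∀ y, Real.sqrt ((((n : ℝ) + 1) ^ d)⁻¹ * ∑ p ∈ B n y'', kerH n a p y ^ 2)
      = Real.sqrt ((((n : ℝ) + 1) ^ d)⁻¹) * Real.sqrt (∑ p ∈ B n y'', kerH n a p y ^ 2) := fun y => Real.sqrt_mul hNi _
  simp_rw [e]
  rw [Real.sqrt_mul hNi]
  calc Real.sqrt ((((n : ℝ) + 1) ^ d)⁻¹) * Real.sqrt (∑ p ∈ B n y'', (∑ y ∈ S, kerH n a p y * Bf y) ^ 2)
      ≤ Real.sqrt ((((n : ℝ) + 1) ^ d)⁻¹) * ∑ y ∈ S, |Bf y| * Real.sqrt (∑ p ∈ B n y'', kerH n a p y ^ 2) :=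
        mul_le_mul_of_nonneg_left (sqrt_sum_sq_HB_le_sum n a y'' S Bf) (Real.sqrt_nonneg _)
    _ = ∑ y ∈ S, |Bf y| * (Real.sqrt ((((n : ℝ) + 1) ^ d)⁻¹) * Real.sqrt (∑ p ∈ B n y'', kerH n a p y ^ 2)) := by
        rw [Finset.mul_sum]; exact Finset.sum_congr rfl fun y _ => by ring

/-! ## §2. The tail of a window -/

/-- **THE TAIL OF A WINDOW, by columns**: `|B| ≤ R` on `S` ⇒ `RMS_{B(y″)}(H_S B) ≤ R·Σ_{y∈S}RMS_{B(y″)}(H(·,y))` — the socket for ONE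
certified tail number. [folklore] -/
theorem blockRMS_HB_le_mul_sum_blockRMS (n : ℕ) (a : ℝ) (y'' : X d) (S : Finset (X d)) (Bf : X d → ℝ) {R : ℝ}
    (hB : ∀ y ∈ S, |Bf y| ≤ R) :
    Real.sqrt ((((n : ℝ) + 1) ^ d)⁻¹ * ∑ p ∈ B n y'', (∑ y ∈ S, kerH n a p y * Bf y) ^ 2)
      ≤ R * ∑ y ∈ S, Real.sqrt ((((n : ℝ) + 1) ^ d)⁻¹ * ∑ p ∈ B n y'', kerH n a p y ^ 2) := by
  refine (blockRMS_HB_le_sum_blockRMS n a y'' S Bf).trans ?_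
  rw [Finset.mul_sum]
  exact Finset.sum_le_sum fun y hy => mul_le_mul_of_nonneg_right (hB y hy) (Real.sqrt_nonneg _)

/-- **THE TAIL OF A WINDOW, by name**: `|B| ≤ R` on `S` (`0 ≤ R`) ⇒ `RMS_{B(y″)}(H_S B) ≤ c_H·R·Σ_{y∈S}e^{−δ_H dist(y″,y)}` (the tree's
`kerH_blockRMS_le` column by column; by value the `10^{366}` family — the SHAPE, not a number). [folklore] -/
theorem blockRMS_HB_tail_le (n : ℕ) {a : ℝ} (ha : 0 < a) (y'' : X d) (S : Finset (X d)) (Bf : X d → ℝ) {R : ℝ}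
    (hR : 0 ≤ R) (hB : ∀ y ∈ S, |Bf y| ≤ R) :
    Real.sqrt ((((n : ℝ) + 1) ^ d)⁻¹ * ∑ p ∈ B n y'', (∑ y ∈ S, kerH n a p y * Bf y) ^ 2)
      ≤ cH d a * R * ∑ y ∈ S, Real.exp (-(deltaH d a * dist y'' y)) := by
  refine (blockRMS_HB_le_mul_sum_blockRMS n a y'' S Bf hB).trans ?_
  calc R * ∑ y ∈ S, Real.sqrt ((((n : ℝ) + 1) ^ d)⁻¹ * ∑ p ∈ B n y'', kerH n a p y ^ 2)
      ≤ R * ∑ y ∈ S, cH d a * Real.exp (-(deltaH d a * dist y'' y)) :=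
        mul_le_mul_of_nonneg_left (Finset.sum_le_sum fun y _ => kerH_blockRMS_le n ha y'' y) hR
    _ = cH d a * R * ∑ y ∈ S, Real.exp (-(deltaH d a * dist y'' y)) := by rw [Finset.mul_sum, Finset.mul_sum]; exact Finset.sum_congr rfl fun y _ => by ring

/-- **A CERTIFIED COLUMN SUP BOUNDS THE COLUMN RMS**: if `|H(p,y)| ≤ m` for every `p ∈ B(y″)` (`0 ≤ m`), then
`RMS_{B(y″)}(H(·,y)) ≤ m` (the block has `(n+1)^d` points, `B6QGQDecay237.card_B`) — so a tail certified as `Σ_{y∉T}max_{p∈B(y″)}|H(p,y)|`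
dominates the tail of `blockRMS_HB_le_mul_sum_blockRMS`. [folklore] -/
theorem blockRMS_col_le_of_abs_le (n : ℕ) (a : ℝ) (y'' y : X d) {m : ℝ} (hm : 0 ≤ m) (hcol : ∀ p ∈ B n y'', |kerH n a p y| ≤ m) :
    Real.sqrt ((((n : ℝ) + 1) ^ d)⁻¹ * ∑ p ∈ B n y'', kerH n a p y ^ 2) ≤ m := by
  have hN : (0 : ℝ) < ((n : ℝ) + 1) ^ d := by positivity
  have h1 : ∑ p ∈ B n y'', kerH n a p y ^ 2 ≤ ∑ p ∈ B n y'', m ^ 2 := by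
    refine Finset.sum_le_sum fun p hp => ?_
    rw [← sq_abs]
    exact pow_le_pow_left₀ (abs_nonneg _) (hcol p hp) 2
  rw [Finset.sum_const, nsmul_eq_mul, B6QGQDecay237.card_B n y''] at h1
  have h2 : (((n : ℝ) + 1) ^ d)⁻¹ * ∑ p ∈ B n y'', kerH n a p y ^ 2 ≤ m ^ 2 := by
    rw [inv_mul_le_iff₀ hN]; exact h1
  calc Real.sqrt ((((n : ℝ) + 1) ^ d)⁻¹ * ∑ p ∈ B n y'', kerH n a p y ^ 2) ≤ Real.sqrt (m ^ 2) := Real.sqrt_le_sqrt h2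
    _ = m := Real.sqrt_sq hm

/-! ## §3. The window split -/

/-- **WINDOW SPLIT (Minkowski on the block)**: for `T ⊆ T′`, `RMS_{B(y″)}(H_{T′}B) ≤ RMS_{B(y″)}(H_T B) + RMS_{B(y″)}(H_{T′∖T}B)`. [folklore] -/
theorem blockRMS_HB_split (n : ℕ) (a : ℝ) (y'' : X d) {T T' : Finset (X d)} (hT : T ⊆ T') (Bf : X d → ℝ) :
    Real.sqrt ((((n : ℝ) + 1) ^ d)⁻¹ * ∑ p ∈ B n y'', (∑ y ∈ T', kerH n a p y * Bf y) ^ 2)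
      ≤ Real.sqrt ((((n : ℝ) + 1) ^ d)⁻¹ * ∑ p ∈ B n y'', (∑ y ∈ T, kerH n a p y * Bf y) ^ 2)
        + Real.sqrt ((((n : ℝ) + 1) ^ d)⁻¹ * ∑ p ∈ B n y'', (∑ y ∈ T' \ T, kerH n a p y * Bf y) ^ 2) := by
  classical
  have hN : (0 : ℝ) < ((n : ℝ) + 1) ^ d := by positivity
  have hNi : 0 ≤ (((n : ℝ) + 1) ^ d)⁻¹ := inv_nonneg.mpr hN.le
  -- `Σ_{T′} = Σ_T + Σ_{T′∖T}`
  have hsplit : ∀ p, ∑ y ∈ T', kerH n a p y * Bf y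
      = (∑ y ∈ T, kerH n a p y * Bf y) + ∑ y ∈ T' \ T, kerH n a p y * Bf y := fun p => by
    rw [← Finset.sum_sdiff hT, add_comm]
  simp_rw [hsplit]
  -- Minkowski on the finite block: `√(Σ(u+v)²) ≤ √(Σu²) + √(Σv²)` (inlined, [folklore])
  have hM : ∀ u v : X d → ℝ, Real.sqrt (∑ p ∈ B n y'', (u p + v p) ^ 2)
      ≤ Real.sqrt (∑ p ∈ B n y'', u p ^ 2) + Real.sqrt (∑ p ∈ B n y'', v p ^ 2) := by
    intro u v
    have hu : 0 ≤ ∑ p ∈ B n y'', u p ^ 2 := Finset.sum_nonneg fun _ _ => sq_nonneg _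
    have hv : 0 ≤ ∑ p ∈ B n y'', v p ^ 2 := Finset.sum_nonneg fun _ _ => sq_nonneg _
    have hrhs : 0 ≤ Real.sqrt (∑ p ∈ B n y'', u p ^ 2) + Real.sqrt (∑ p ∈ B n y'', v p ^ 2) := by positivity
    rw [Real.sqrt_le_left hrhs]
    have hcs : (∑ p ∈ B n y'', u p * v p) ^ 2 ≤ (∑ p ∈ B n y'', u p ^ 2) * (∑ p ∈ B n y'', v p ^ 2) :=
      Finset.sum_mul_sq_le_sq_mul_sq (B n y'') u v
    have hcs' : ∑ p ∈ B n y'', u p * v p ≤ Real.sqrt (∑ p ∈ B n y'', u p ^ 2) * Real.sqrt (∑ p ∈ B n y'', v p ^ 2) := by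
      rw [← Real.sqrt_mul hu]
      refine (le_abs_self _).trans ?_
      rw [← Real.sqrt_sq_eq_abs]
      exact Real.sqrt_le_sqrt hcs
    have e : ∑ p ∈ B n y'', (u p + v p) ^ 2
        = ∑ p ∈ B n y'', u p ^ 2 + ∑ p ∈ B n y'', v p ^ 2 + 2 * ∑ p ∈ B n y'', u p * v p := by
      rw [← Finset.sum_add_distrib, Finset.mul_sum, ← Finset.sum_add_distrib]
      exact Finset.sum_congr rfl fun p _ => by ring
    rw [e, add_sq, Real.sq_sqrt hu, Real.sq_sqrt hv]
    nlinarith [hcs']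
  have h := hM (fun p => ∑ y ∈ T, kerH n a p y * Bf y) (fun p => ∑ y ∈ T' \ T, kerH n a p y * Bf y)
  rw [Real.sqrt_mul hNi, Real.sqrt_mul hNi, Real.sqrt_mul hNi, ← mul_add]
  exact mul_le_mul_of_nonneg_left h (Real.sqrt_nonneg _)

/-! ## §4. The glued letters: certificate on the window, tail outside -/

/-- **THE GLUED LETTER — OSCMN §5's CERTIFICATE ON THE WINDOW `T`, THE TAIL ON `T′ ∖ T` BY COLUMNS**: for `T ⊆ T′`, a dual certificate `(w, λ)`
on `T` (hypothesis `hdual` of `blockRMS_HB_le_of_certificate`) and `|B| ≤ R` on `T′` (`0 ≤ R`):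
`RMS_{B(y″)}(H_{T′}B) ≤ √(λ(Σ_{y∈T}w_y)∕(n+1)^d)·R + R·Σ_{y∈T′∖T}RMS_{B(y″)}(H(·,y))`. [folklore] -/
theorem blockRMS_HB_le_of_certificate_window (n : ℕ) (a : ℝ) (y'' : X d) {T T' : Finset (X d)} (hT : T ⊆ T')
    (w : X d → ℝ) (lam : ℝ) (hw : ∀ y ∈ T, 0 < w y) (hlam : 0 ≤ lam)
    (hdual : ∀ v : X d → ℝ, ∑ y ∈ T, (∑ p ∈ B n y'', v p * kerH n a p y) ^ 2 / w y ≤ lam * ∑ p ∈ B n y'', v p ^ 2)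
    (Bf : X d → ℝ) {R : ℝ} (hR : 0 ≤ R) (hB : ∀ y ∈ T', |Bf y| ≤ R) :
    Real.sqrt ((((n : ℝ) + 1) ^ d)⁻¹ * ∑ p ∈ B n y'', (∑ y ∈ T', kerH n a p y * Bf y) ^ 2)
      ≤ Real.sqrt (lam * (∑ y ∈ T, w y) / ((n : ℝ) + 1) ^ d) * R
        + R * ∑ y ∈ T' \ T, Real.sqrt ((((n : ℝ) + 1) ^ d)⁻¹ * ∑ p ∈ B n y'', kerH n a p y ^ 2) := by
  refine (blockRMS_HB_split n a y'' hT Bf).trans (add_le_add ?_ ?_)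
  · exact blockRMS_HB_le_of_certificate n a y'' T w lam hw hlam hdual Bf hR fun y hy => hB y (hT hy)
  · exact blockRMS_HB_le_mul_sum_blockRMS n a y'' (T' \ T) Bf fun y hy => hB y (Finset.sdiff_subset hy)

/-- **ONE-LINE SUBSTITUTION FORM**: a certificate `(w, λ)` on `T ⊆ T′` and ONE tail number `τ ≥ Σ_{y∈T′∖T}RMS_{B(y″)}(H(·,y))` give
`RMS_{B(y″)}(H_{T′}B) ≤ (√(λ(Σ_{y∈T}w_y)∕(n+1)^d) + τ)·R` for every `|B| ≤ R` on `T′` — F733 (d)'s «window + tail» in the currency of record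
(NC-NE7b-GAMMA-1's `(w, λ)` on `T_r` and its tail `τ_r` enter here as displayed hypotheses; the kernel evaluates nothing). [folklore] -/
theorem blockRMS_HB_le_of_certificate_add_tail (n : ℕ) (a : ℝ) (y'' : X d) {T T' : Finset (X d)} (hT : T ⊆ T')
    (w : X d → ℝ) (lam : ℝ) (hw : ∀ y ∈ T, 0 < w y) (hlam : 0 ≤ lam)
    (hdual : ∀ v : X d → ℝ, ∑ y ∈ T, (∑ p ∈ B n y'', v p * kerH n a p y) ^ 2 / w y ≤ lam * ∑ p ∈ B n y'', v p ^ 2)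
    {τ : ℝ} (htail : ∑ y ∈ T' \ T, Real.sqrt ((((n : ℝ) + 1) ^ d)⁻¹ * ∑ p ∈ B n y'', kerH n a p y ^ 2) ≤ τ)
    (Bf : X d → ℝ) {R : ℝ} (hR : 0 ≤ R) (hB : ∀ y ∈ T', |Bf y| ≤ R) :
    Real.sqrt ((((n : ℝ) + 1) ^ d)⁻¹ * ∑ p ∈ B n y'', (∑ y ∈ T', kerH n a p y * Bf y) ^ 2)
      ≤ (Real.sqrt (lam * (∑ y ∈ T, w y) / ((n : ℝ) + 1) ^ d) + τ) * R := by
  refine (blockRMS_HB_le_of_certificate_window n a y'' hT w lam hw hlam hdual Bf hR hB).trans ?_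
  rw [add_mul]
  refine add_le_add le_rfl ?_
  rw [mul_comm]
  exact mul_le_mul_of_nonneg_right htail hR

/-- **THE GLUED LETTER BY NAME**: the same with the tail bounded by the tree's decay —
`RMS_{B(y″)}(H_{T′}B) ≤ √(λ(Σ_{y∈T}w_y)∕(n+1)^d)·R + c_H·R·Σ_{y∈T′∖T}e^{−δ_H dist(y″,y)}` (`a > 0`). [folklore] -/
theorem blockRMS_HB_le_of_certificate_window_byName (n : ℕ) {a : ℝ} (ha : 0 < a) (y'' : X d) {T T' : Finset (X d)} (hT : T ⊆ T')
    (w : X d → ℝ) (lam : ℝ) (hw : ∀ y ∈ T, 0 < w y) (hlam : 0 ≤ lam)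
    (hdual : ∀ v : X d → ℝ, ∑ y ∈ T, (∑ p ∈ B n y'', v p * kerH n a p y) ^ 2 / w y ≤ lam * ∑ p ∈ B n y'', v p ^ 2)
    (Bf : X d → ℝ) {R : ℝ} (hR : 0 ≤ R) (hB : ∀ y ∈ T', |Bf y| ≤ R) :
    Real.sqrt ((((n : ℝ) + 1) ^ d)⁻¹ * ∑ p ∈ B n y'', (∑ y ∈ T', kerH n a p y * Bf y) ^ 2)
      ≤ Real.sqrt (lam * (∑ y ∈ T, w y) / ((n : ℝ) + 1) ^ d) * R
        + cH d a * R * ∑ y ∈ T' \ T, Real.exp (-(deltaH d a * dist y'' y)) := by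
  refine (blockRMS_HB_split n a y'' hT Bf).trans (add_le_add ?_ ?_)
  · exact blockRMS_HB_le_of_certificate n a y'' T w lam hw hlam hdual Bf hR fun y hy => hB y (hT hy)
  · exact blockRMS_HB_tail_le n ha y'' (T' \ T) Bf hR fun y hy => hB y (Finset.sdiff_subset hy)

end Summit.QuantumFields.BalabanUV.T4Continuum.NE7b.OneShotChartMixedNormTail
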